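import Summits.BirchSwinnertonDyer.BirchSwinnertonDyer.Theorems.ManinLocalTwoThreeComplexAutExtension
import HarnessLib

/-!
# AUT-EXT consequences: automorphisms of `ℂ` with prescribed action on `ζ_N` and on `√δ`
(route `ManinLocalTwoThree`, crux C2 `ManinOddAtFour` stmt-BirchSwinnertonDyer-22967; cell bsd-f2-manin, C2/C3 LEAD p1 gen 19;
`--supports stmt-BirchSwinnertonDyer-22967`; LEAD planning flag «AUT-EXT» 2026-08-30T04:20Z; uses `ComplexAut.exists_complex_algEquiv_extends`)

The two supplies the D5→D6 bridge of E-es-185 consumes: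
* `exists_complex_algEquiv_exp_pow` — for every `d` coprime to `N` there is `σ : ℂ ≃ₐ[ℚ] ℂ` with
  `σ(e^{2πi/N}) = (e^{2πi/N})^d` (cyclotomic Galois theory `IsCyclotomicExtension.autEquivPow` + AUT-EXT): THIS is what lets one
  instantiate T-es-75 / `theoremK_core` / `indexFour_kummerDiamondReciprocity` at every `d ∈ (ℤ/N)ˣ`;
* `exists_complex_algEquiv_neg_sqrt` — for a non-square `δ ∈ ℚ` and `w² = δ` there is `σ : ℂ ≃ₐ[ℚ] ℂ` with `σ w = −w`
  (Kummer injectivity for quadratic characters: a rational number fixed-up-to-sign by every `σ` … is a square).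

Pure field theory; nothing about C2, Manin's conjecture or BSD is proved here.  [folklore]
-/

set_option autoImplicit false
-- lint-debt: the directory name repeats the summit name (sibling precedent `ManinLocalTwoThreeComplexAutExtension.lean`)
set_option linter.dupNamespace false

noncomputable section

open scoped Classical
open Polynomial IntermediateField

namespace Summit.BirchSwinnertonDyer.BirchSwinnertonDyer.Theorems.ManinLocalTwoThree.ComplexAut

/-! ## §1 Prescribed action on `ζ_N = e^{2πi/N}` -/

/-- **Cyclotomic supply.**  For `N ≠ 0` and `d` coprime to `N` there is a `ℚ`-algebra automorphism `σ` of `ℂ` with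
`σ(e^{2πi/N}) = (e^{2πi/N})^d`. [folklore] -/
theorem exists_complex_algEquiv_exp_pow (N : ℕ) (hN : N ≠ 0) (d : ℕ) (hd : d.Coprime N) :
    ∃ σ : ℂ ≃ₐ[ℚ] ℂ, σ (Complex.exp (2 * Real.pi * Complex.I / N)) = Complex.exp (2 * Real.pi * Complex.I / N) ^ d := by
  haveI : NeZero N := ⟨hN⟩
  set ζ : ℂ := Complex.exp (2 * Real.pi * Complex.I / N) with hζdef
  have hζ : IsPrimitiveRoot ζ N := Complex.isPrimitiveRoot_exp N hN
  set L : IntermediateField ℚ ℂ := ℚ⟮ζ⟯ with hL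
  have hint : IsIntegral ℚ ζ := (hζ.isIntegral (Nat.pos_of_ne_zero hN)).tower_top
  haveI : IsCyclotomicExtension {N} ℚ L := by
    change IsCyclotomicExtension {N} ℚ (IntermediateField.adjoin ℚ {ζ}).toSubalgebra
    rw [IntermediateField.adjoin_simple_toSubalgebra_of_isAlgebraic hint.isAlgebraic]
    exact hζ.adjoin_isCyclotomicExtension ℚ
  have hirr : Irreducible (cyclotomic N ℚ) := cyclotomic.irreducible_rat (Nat.pos_of_ne_zero hN)
  -- the automorphism of `L` attached to the unit `d`
  set u : (ZMod N)ˣ := ZMod.unitOfCoprime d hd with hu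
  set τ : L ≃ₐ[ℚ] L := (IsCyclotomicExtension.autEquivPow L hirr).symm u with hτ
  have hz := IsCyclotomicExtension.zeta_spec N ℚ L
  have hτz : τ (IsCyclotomicExtension.zeta N ℚ L) = IsCyclotomicExtension.zeta N ℚ L ^ (d % N) := by
    have h1 : IsCyclotomicExtension.autEquivPow L hirr τ = u := by rw [hτ, MulEquiv.apply_symm_apply]
    rw [IsCyclotomicExtension.autEquivPow_apply] at h1
    have h1' : hz.autToPow ℚ τ = u := by simpa [MonoidHom.toFun_eq_coe] using h1
    have h2 := hz.autToPow_spec ℚ τ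
    rw [h1', hu, ZMod.coe_unitOfCoprime, ZMod.val_natCast] at h2
    exact h2.symm
  -- our `ζ`, as an element of `L`, is a power of `zeta`
  set z : L := ⟨ζ, mem_adjoin_simple_self ℚ ζ⟩ with hzdef
  have hzN : z ^ N = 1 := by
    apply Subtype.ext
    show ((z ^ N : L) : ℂ) = 1
    rw [SubmonoidClass.coe_pow]
    exact hζ.pow_eq_one
  obtain ⟨k, -, hk⟩ := hz.eq_pow_of_pow_eq_one hzN
  have hτζ : τ z = z ^ d := by
    rw [← hk, map_pow, hτz, ← pow_mul, mul_comm, pow_mul]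
    -- `(zeta^k)^(d % N) = (zeta^k)^d`
    rw [hk]
    conv_rhs => rw [← Nat.div_add_mod d N, pow_add, pow_mul, hzN, one_pow, one_mul]
  obtain ⟨σ, hσ⟩ := exists_complex_algEquiv_extends L τ
  refine ⟨σ, ?_⟩
  have := hσ z
  rw [hτζ, SubmonoidClass.coe_pow] at this
  exact this

/-! ## §2 Sign change on `√δ` -/

/-- **Quadratic supply.**  If `δ ∈ ℚ` is not a square and `w ∈ ℂ` with `w² = δ`, some `ℚ`-algebra automorphism `σ` of `ℂ`
has `σ w = −w`. [folklore] -/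
theorem exists_complex_algEquiv_neg_sqrt (δ : ℚ) (hδ : ∀ b : ℚ, b ^ 2 ≠ δ) (w : ℂ) (hw : w ^ 2 = (δ : ℂ)) :
    ∃ σ : ℂ ≃ₐ[ℚ] ℂ, σ w = -w := by
  -- `X² − δ` is irreducible, hence the minimal polynomial of `w`
  have hirr : Irreducible (X ^ 2 - C δ : ℚ[X]) := X_pow_sub_C_irreducible_of_prime Nat.prime_two hδ
  have hmonic : (X ^ 2 - C δ : ℚ[X]).Monic := monic_X_pow_sub_C δ two_ne_zero
  have hroot : aeval w (X ^ 2 - C δ : ℚ[X]) = 0 := by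
    simp only [map_sub, map_pow, aeval_X, aeval_C, eq_ratCast, hw, sub_self]
  have hmin : minpoly ℚ w = X ^ 2 - C δ := (minpoly.eq_of_irreducible_of_monic hirr hroot hmonic).symm
  have hint : IsIntegral ℚ w := ⟨X ^ 2 - C δ, hmonic, by simpa [eval₂_eq_eval_map, aeval_def] using hroot⟩
  haveI : FiniteDimensional ℚ ℚ⟮w⟯ := adjoin.finiteDimensional hint
  -- `−w ∈ ℚ⟮w⟯` is a root of the minimal polynomial
  set w' : ℚ⟮w⟯ := -⟨w, mem_adjoin_simple_self ℚ w⟩ with hw'def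
  have hw'root : w' ∈ (minpoly ℚ w).aroots ℚ⟮w⟯ := by
    rw [hmin, mem_aroots]
    refine ⟨hirr.ne_zero, ?_⟩
    have hcoe : algebraMap ℚ⟮w⟯ ℂ w' = -w := by rw [hw'def, map_neg]; rfl
    have key : aeval (algebraMap ℚ⟮w⟯ ℂ w') (X ^ 2 - C δ : ℚ[X]) = 0 := by
      rw [hcoe]
      simp only [map_sub, map_pow, aeval_X, aeval_C, eq_ratCast, neg_sq, hw, sub_self]
    rw [Polynomial.aeval_algebraMap_apply, map_eq_zero_iff _ (algebraMap ℚ⟮w⟯ ℂ).injective] at key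
    exact key
  set φ : ℚ⟮w⟯ →ₐ[ℚ] ℚ⟮w⟯ := (algHomAdjoinIntegralEquiv ℚ hint).symm ⟨w', hw'root⟩ with hφ
  have hφw : φ (AdjoinSimple.gen ℚ w) = w' := algHomAdjoinIntegralEquiv_symm_apply_gen ℚ hint ⟨w', hw'root⟩
  set τ : ℚ⟮w⟯ ≃ₐ[ℚ] ℚ⟮w⟯ := AlgEquiv.ofBijective φ (Algebra.IsAlgebraic.algHom_bijective φ) with hτ
  obtain ⟨σ, hσ⟩ := exists_complex_algEquiv_extends ℚ⟮w⟯ τ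
  refine ⟨σ, ?_⟩
  have := hσ (AdjoinSimple.gen ℚ w)
  rw [hτ, AlgEquiv.ofBijective_apply, hφw, hw'def] at this
  simpa using this

end Summit.BirchSwinnertonDyer.BirchSwinnertonDyer.Theorems.ManinLocalTwoThree.ComplexAut

end
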